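import Summits.AtomisticToContinuum.BoseEinsteinCondensation.Theses.BECWallDressingTransfer
import Literature.MathematicalPhysics.QuantumManyBody.BoseEinsteinCondensation
import Literature.MathematicalPhysics.QuantumManyBody.SwapPurity
import Literature.MathematicalPhysics.QuantumManyBody.CondensateOccupationStability

/-!
# Route `BECThomsonPrinciple`, crux `PeriodicToDirichlet` (stmt-AtomisticToContinuum-9483),
# line `Sketch` (torus-in-the-box-doob): registered stub `stub_nearMinimiserTransfer`

Condensed near-minimisers at every slack + `L²`-rigidity of near-minimisers up to phase
(stmt-AtomisticToContinuum-9072, `BECWallDressingTransfer.GroundStateRigidity`) ⇒ every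
`δ`-near-minimiser is inner-flat condensed. Pure measure theory: `√occ_φ` is `√N‖φ‖₂`-Lipschitz in
`L²` and phase-invariant. [folklore]

The pattern is `Literature/MathematicalPhysics/QuantumManyBody/CondensateOccupationStability.lean`
(periodic constant mode, integrals over the cell); here the mode is a general bounded measurable
one-body function supported in the cell and the `N`-body integrals run over all of `(ℝ³)^N`
(`BoseGas.occupation`): `a_φ(Ψ)(Y) = ∫ conj φ(x) Ψ(x::Y) dx` is linear in `Ψ`, so Minkowski in
`L²((ℝ³)^{N-1})` makes `√occ_φ = √N ‖a_φ(·)‖₂` a seminorm, and Cauchy–Schwarz in `x` plus Tonelli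
(`lintegral_lintegral_sq_nnnorm_vecCons`) bound it by `√N ‖φ‖₂ ‖Ψ‖₂`.
-/

noncomputable section

open MeasureTheory Filter
open scoped ENNReal NNReal ComplexConjugate

namespace Summit.AtomisticToContinuum.BoseEinsteinCondensation.TorusInTheBox

open Literature.MathematicalPhysics.QuantumManyBody.BoseGas
open Summit.AtomisticToContinuum.BoseEinsteinCondensation.Theses

/-! ### `√occ_φ` is a seminorm bounded by `√N ‖φ‖₂ ‖·‖₂` -/

/-- `Y ↦ a_φ(Ψ)(Y) = ∫ conj φ(x) Ψ(x::Y) dx` is measurable for measurable `φ`, `Ψ`. [folklore] -/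
private theorem measurable_integral_conj_mul_vecCons {φ : Space → ℂ} (hφ : Measurable φ) {n : ℕ}
    {Ψ : Config (n + 1) → ℂ} (hΨ : Measurable Ψ) :
    Measurable fun Y : Config n => ∫ x, conj (φ x) * Ψ (Matrix.vecCons x Y) := by
  have h : StronglyMeasurable (Function.uncurry fun (Y : Config n) (x : Space) =>
      conj (φ x) * Ψ (Matrix.vecCons x Y)) := by
    refine Measurable.stronglyMeasurable ?_
    exact (Complex.continuous_conj.measurable.comp (hφ.comp measurable_snd)).mul
      (hΨ.comp (continuous_snd.matrixVecCons continuous_fst).measurable)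
  exact (h.integral_prod_right' (ν := (volume : Measure Space))).measurable

/-- **`√occ_φ` is a seminorm**: `occ_φ(Ψ₁)^{1/2} ≤ occ_φ(Ψ₂)^{1/2} + occ_φ(Ψ₁ - Ψ₂)^{1/2}` for
measurable `N = n+1`-body functions whose slices pair integrably with `φ` (linearity of
`a_φ(Ψ)(Y) = ∫ conj φ(x) Ψ(x::Y) dx` in `Ψ`, the pointwise triangle inequality, and Minkowski in
`L²((ℝ³)ⁿ)`). [folklore] -/
private theorem occupation_rpow_half_le_add {φ : Space → ℂ} (hφ : Measurable φ) {n : ℕ}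
    {Ψ₁ Ψ₂ : Config (n + 1) → ℂ} (hΨ₁ : Measurable Ψ₁) (hΨ₂ : Measurable Ψ₂)
    (h₁ : ∀ Y : Config n, Integrable (fun x => conj (φ x) * Ψ₁ (Matrix.vecCons x Y)))
    (h₂ : ∀ Y : Config n, Integrable (fun x => conj (φ x) * Ψ₂ (Matrix.vecCons x Y))) :
    occupation (n + 1) φ Ψ₁ ^ (1 / 2 : ℝ) ≤
      occupation (n + 1) φ Ψ₂ ^ (1 / 2 : ℝ) +
        occupation (n + 1) φ (fun X => Ψ₁ X - Ψ₂ X) ^ (1 / 2 : ℝ) := by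
  have h₃ : ∀ Y : Config n, Integrable
      (fun x => conj (φ x) * (Ψ₁ (Matrix.vecCons x Y) - Ψ₂ (Matrix.vecCons x Y))) := fun Y =>
    ((h₁ Y).sub (h₂ Y)).congr (ae_of_all _ fun x => by simp only [Pi.sub_apply, mul_sub])
  -- linearity of `a_φ`
  have hlin : ∀ Y : Config n, ∫ x, conj (φ x) * Ψ₁ (Matrix.vecCons x Y) =
      (∫ x, conj (φ x) * Ψ₂ (Matrix.vecCons x Y)) +
        ∫ x, conj (φ x) * (Ψ₁ (Matrix.vecCons x Y) - Ψ₂ (Matrix.vecCons x Y)) := fun Y => by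
    rw [← integral_add (h₂ Y) (h₃ Y)]
    congr 1
    funext x
    ring
  -- pointwise triangle inequality
  have hpt : ∀ Y : Config n, (‖∫ x, conj (φ x) * Ψ₁ (Matrix.vecCons x Y)‖₊ : ℝ≥0∞) ≤
      (‖∫ x, conj (φ x) * Ψ₂ (Matrix.vecCons x Y)‖₊ : ℝ≥0∞) +
        (‖∫ x, conj (φ x) * (Ψ₁ (Matrix.vecCons x Y) - Ψ₂ (Matrix.vecCons x Y))‖₊ : ℝ≥0∞) :=
    fun Y => by
    rw [hlin Y]
    exact_mod_cast nnnorm_add_le _ _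
  -- Minkowski in `L²((ℝ³)ⁿ)`
  have hm₂ : AEMeasurable
      (fun Y : Config n => (‖∫ x, conj (φ x) * Ψ₂ (Matrix.vecCons x Y)‖₊ : ℝ≥0∞)) volume :=
    (measurable_integral_conj_mul_vecCons hφ hΨ₂).nnnorm.coe_nnreal_ennreal.aemeasurable
  have hm₃ : AEMeasurable (fun Y : Config n =>
      (‖∫ x, conj (φ x) * (Ψ₁ (Matrix.vecCons x Y) - Ψ₂ (Matrix.vecCons x Y))‖₊ : ℝ≥0∞))
      volume :=
    (measurable_integral_conj_mul_vecCons hφ (hΨ₁.sub hΨ₂)).nnnorm.coe_nnreal_ennreal.aemeasurable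
  have hmink := ENNReal.lintegral_Lp_add_le hm₂ hm₃ (by norm_num : (1 : ℝ) ≤ 2)
  simp only [Pi.add_apply, ENNReal.rpow_two] at hmink
  have hI : (∫⁻ Y : Config n,
      (‖∫ x, conj (φ x) * Ψ₁ (Matrix.vecCons x Y)‖₊ : ℝ≥0∞) ^ 2) ^ (1 / 2 : ℝ) ≤
      (∫⁻ Y : Config n,
        (‖∫ x, conj (φ x) * Ψ₂ (Matrix.vecCons x Y)‖₊ : ℝ≥0∞) ^ 2) ^ (1 / 2 : ℝ) +
      (∫⁻ Y : Config n,
        (‖∫ x, conj (φ x) * (Ψ₁ (Matrix.vecCons x Y) - Ψ₂ (Matrix.vecCons x Y))‖₊ : ℝ≥0∞) ^ 2) ^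
          (1 / 2 : ℝ) := by
    refine le_trans ?_ hmink
    gcongr with Y
    exact hpt Y
  simp only [occupation]
  rw [ENNReal.mul_rpow_of_nonneg _ _ (by norm_num : (0 : ℝ) ≤ 1 / 2),
    ENNReal.mul_rpow_of_nonneg _ _ (by norm_num : (0 : ℝ) ≤ 1 / 2),
    ENNReal.mul_rpow_of_nonneg _ _ (by norm_num : (0 : ℝ) ≤ 1 / 2), ← mul_add]
  exact mul_le_mul_right hI _

/-- **`a_φ` is bounded by `√N ‖φ‖₂`**: `occ_φ(Ψ) ≤ N ‖φ‖₂² ‖Ψ‖₂²` for measurable `φ`, `Ψ`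
(Cauchy–Schwarz in the contracted particle, then Tonelli `∫ dŶ ∫ dx |Ψ(x::Ŷ)|² = ‖Ψ‖₂²`).
[folklore] -/
private theorem occupation_le_mul_lintegral {φ : Space → ℂ} (hφ : Measurable φ) :
    ∀ {N : ℕ} {Ψ : Config N → ℂ}, Measurable Ψ →
      occupation N φ Ψ ≤
        (N : ℝ≥0∞) * (∫⁻ x, (‖φ x‖₊ : ℝ≥0∞) ^ 2) * ∫⁻ X, (‖Ψ X‖₊ : ℝ≥0∞) ^ 2
  | 0, _, _ => by simp [occupation]
  | n + 1, Ψ, hΨ => by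
    have hpt : ∀ Y : Config n, (‖∫ x, conj (φ x) * Ψ (Matrix.vecCons x Y)‖₊ : ℝ≥0∞) ^ 2 ≤
        (∫⁻ x, (‖Ψ (Matrix.vecCons x Y)‖₊ : ℝ≥0∞) ^ 2) * ∫⁻ x, (‖φ x‖₊ : ℝ≥0∞) ^ 2 := by
      intro Y
      have h := sq_nnnorm_integral_mul_conj_le (ν := (volume : Measure Space))
        (measurable_comp_vecCons_left hΨ Y).aemeasurable hφ.aemeasurable
      have hfun : (fun x => conj (φ x) * Ψ (Matrix.vecCons x Y)) =
          fun x => Ψ (Matrix.vecCons x Y) * conj (φ x) := funext fun x => mul_comm _ _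
      rwa [hfun]
    calc occupation (n + 1) φ Ψ
        = (n + 1 : ℝ≥0∞) *
            ∫⁻ Y : Config n, (‖∫ x, conj (φ x) * Ψ (Matrix.vecCons x Y)‖₊ : ℝ≥0∞) ^ 2 := rfl
      _ ≤ (n + 1 : ℝ≥0∞) * ∫⁻ Y : Config n,
            (∫⁻ x, (‖Ψ (Matrix.vecCons x Y)‖₊ : ℝ≥0∞) ^ 2) * ∫⁻ x, (‖φ x‖₊ : ℝ≥0∞) ^ 2 := by
          gcongr with Y
          exact hpt Y
      _ = (n + 1 : ℝ≥0∞) *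
            ((∫⁻ X, (‖Ψ X‖₊ : ℝ≥0∞) ^ 2) * ∫⁻ x, (‖φ x‖₊ : ℝ≥0∞) ^ 2) := by
          rw [lintegral_mul_const _ (measurable_lintegral_sq_nnnorm_vecCons hΨ),
            lintegral_lintegral_sq_nnnorm_vecCons hΨ]
      _ = ((n + 1 : ℕ) : ℝ≥0∞) * (∫⁻ x, (‖φ x‖₊ : ℝ≥0∞) ^ 2) * ∫⁻ X, (‖Ψ X‖₊ : ℝ≥0∞) ^ 2 := by
          push_cast
          ring

/-- **`L²`-Lipschitz bound of `√occ_φ` on trial states, modulo a phase**: for a bounded measurable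
mode `φ` supported in the cell with `‖φ‖₂ ≤ 1`, Dirichlet trial states `Ψ, Φ` and a phase `c₁`
with `∫ |Ψ - c₁Φ|² ≤ η`: `occ_φ(Φ)^{1/2} ≤ occ_φ(Ψ)^{1/2} + (N η)^{1/2}` (phase invariance
`occupation_const_mul`, the seminorm property and the bound `occ_φ ≤ N‖φ‖₂²‖·‖₂²`). [folklore] -/
private theorem occupation_rpow_half_le_add_of_sq_dist_le {N : ℕ} {L : ℝ} {φ : Space → ℂ}
    (hφm : Measurable φ) {C : ℝ} (hφC : ∀ x, ‖φ x‖ ≤ C) (hφ0 : ∀ x, x ∉ cell L → φ x = 0)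
    (hφ1 : ∫⁻ x, (‖φ x‖₊ : ℝ≥0∞) ^ 2 ≤ 1) (Ψ Φ : TrialState N L) {c₁ : ℂ} (hc₁ : ‖c₁‖ = 1)
    {η : ℝ≥0∞} (hdist : ∫⁻ X, (‖Ψ.ψ X - c₁ * Φ.ψ X‖₊ : ℝ≥0∞) ^ 2 ≤ η) :
    occupation N φ Φ.ψ ^ (1 / 2 : ℝ) ≤
      occupation N φ Ψ.ψ ^ (1 / 2 : ℝ) + ((N : ℝ≥0∞) * η) ^ (1 / 2 : ℝ) := by
  cases N with
  | zero => simp [occupation]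
  | succ n =>
    have hΨc : Continuous Ψ.ψ := Ψ.contDiff.continuous
    have hΦc : Continuous fun X => c₁ * Φ.ψ X := continuous_const.mul Φ.contDiff.continuous
    -- integrability of the slices against `φ` (bounded mode, support in the bounded cell)
    have hint : ∀ {F : Config (n + 1) → ℂ}, Continuous F → ∀ Y : Config n,
        Integrable (fun x => conj (φ x) * F (Matrix.vecCons x Y)) := by
      intro F hF Y
      refine (integrableOn_iff_integrable_of_support_subset (s := cell L)
        (μ := (volume : Measure Space)) ?_).1
        (integrableOn_cell_conj_mul hφm hφC (continuous_vecCons_slice hF Y))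
      intro x hx
      by_contra hxs
      exact hx (by simp only [hφ0 x hxs, map_zero, zero_mul])
    -- phase invariance
    have hphase : occupation (n + 1) φ (fun X => c₁ * Φ.ψ X) = occupation (n + 1) φ Φ.ψ := by
      have h1 : ((‖c₁‖₊ : ℝ≥0∞) ^ 2) = 1 := by
        rw [← enorm_eq_nnnorm, ← ofReal_norm, hc₁]
        simp
      rw [occupation_const_mul, h1, one_mul]
    have hsemi := occupation_rpow_half_le_add hφm hΦc.measurable hΨc.measurable (hint hΦc)
      (hint hΨc)
    rw [hphase] at hsemi
    -- `occ_φ(c₁Φ - Ψ) ≤ N ‖φ‖₂² ‖c₁Φ - Ψ‖₂² ≤ N η`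
    have hsymm : ∫⁻ X, (‖c₁ * Φ.ψ X - Ψ.ψ X‖₊ : ℝ≥0∞) ^ 2 =
        ∫⁻ X, (‖Ψ.ψ X - c₁ * Φ.ψ X‖₊ : ℝ≥0∞) ^ 2 := by
      refine lintegral_congr fun X => ?_
      rw [← enorm_eq_nnnorm, enorm_sub_rev, enorm_eq_nnnorm]
    have hbd : occupation (n + 1) φ (fun X => c₁ * Φ.ψ X - Ψ.ψ X) ≤ ((n + 1 : ℕ) : ℝ≥0∞) * η :=
      calc occupation (n + 1) φ (fun X => c₁ * Φ.ψ X - Ψ.ψ X)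
          ≤ ((n + 1 : ℕ) : ℝ≥0∞) * (∫⁻ x, (‖φ x‖₊ : ℝ≥0∞) ^ 2) *
              ∫⁻ X, (‖c₁ * Φ.ψ X - Ψ.ψ X‖₊ : ℝ≥0∞) ^ 2 :=
            occupation_le_mul_lintegral hφm (hΦc.sub hΨc).measurable
        _ ≤ ((n + 1 : ℕ) : ℝ≥0∞) * 1 * η := by
            rw [hsymm]
            gcongr
        _ = ((n + 1 : ℕ) : ℝ≥0∞) * η := by rw [mul_one]
    refine hsemi.trans ?_
    gcongr

/-! ### The inner flat mode -/

/-- Coordinate cubes `{x | ∀ t, x t ∈ (a, b)}` of `ℝ³` are measurable. [folklore] -/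
private theorem measurableSet_coordCube (a b : ℝ) :
    MeasurableSet {x : Space | ∀ t, x t ∈ Set.Ioo a b} := by
  have : {x : Space | ∀ t, x t ∈ Set.Ioo a b} =
      ⋂ k : Fin 3, (fun x : Space => x k) ⁻¹' Set.Ioo a b := by
    ext x
    simp
  rw [this]
  exact MeasurableSet.iInter fun k => measurableSet_Ioo.preimage (by fun_prop)

/-- `|{x | ∀ t, x t ∈ (a, b)}| = (b - a)³` (Lebesgue measure on `EuclideanSpace ℝ (Fin 3)` is the
product measure transported by `WithLp.ofLp`; junk value `0` for `b ≤ a`). [folklore] -/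
private theorem volume_coordCube (a b : ℝ) :
    volume {x : Space | ∀ t, x t ∈ Set.Ioo a b} = ENNReal.ofReal (b - a) ^ 3 := by
  have h : {x : Space | ∀ t, x t ∈ Set.Ioo a b} =
      (@WithLp.ofLp 2 (Fin 3 → ℝ)) ⁻¹' (Set.univ.pi fun _ => Set.Ioo a b) := by
    ext x
    simp
  rw [h, (PiLp.volume_preserving_ofLp (Fin 3)).measure_preimage
    (MeasurableSet.univ_pi fun _ => measurableSet_Ioo).nullMeasurableSet, volume_pi_pi]
  simp

/-- **The inner flat mode is `L²`-normalised**: `∫ |φ_{θ,L}|² = ((1-2θ)L)⁻³ · |(θL, L-θL)³| = 1`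
for `(1 - 2θ)L > 0`. [folklore] -/
private theorem lintegral_innerFlatMode_sq {θ L : ℝ} (h : 0 < (1 - 2 * θ) * L) :
    ∫⁻ x, (‖Set.indicator {x : Space | ∀ t, x t ∈ Set.Ioo (θ * L) (L - θ * L)}
        (fun _ => ((Real.sqrt (((1 - 2 * θ) * L) ^ 3))⁻¹ : ℂ)) x‖₊ : ℝ≥0∞) ^ 2 = 1 := by
  set S : Set Space := {x : Space | ∀ t, x t ∈ Set.Ioo (θ * L) (L - θ * L)} with hS
  have hM3 : 0 < ((1 - 2 * θ) * L) ^ 3 := pow_pos h 3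
  have h1 : (fun x => (‖S.indicator (fun _ => ((Real.sqrt (((1 - 2 * θ) * L) ^ 3))⁻¹ : ℂ)) x‖₊ :
      ℝ≥0∞) ^ 2) = S.indicator (fun _ => ENNReal.ofReal ((((1 - 2 * θ) * L) ^ 3)⁻¹)) := by
    funext x
    by_cases hx : x ∈ S
    · simp only [Set.indicator_of_mem hx]
      rw [← ENNReal.coe_pow, ENNReal.ofReal, ENNReal.coe_inj]
      ext
      rw [NNReal.coe_pow, coe_nnnorm, norm_inv, Complex.norm_real,
        Real.norm_of_nonneg (Real.sqrt_nonneg _), inv_pow, Real.sq_sqrt hM3.le,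
        Real.coe_toNNReal _ (by positivity)]
    · simp [hx]
  rw [h1, lintegral_indicator (measurableSet_coordCube _ _), setLIntegral_const,
    volume_coordCube, show L - θ * L - θ * L = (1 - 2 * θ) * L by ring,
    ← ENNReal.ofReal_pow h.le, ← ENNReal.ofReal_mul (by positivity), inv_mul_cancel₀ hM3.ne',
    ENNReal.ofReal_one]

/-! ### The bookkeeping `√(cN) ≤ √occ + √(cN)/4 ⇒ (c/4)N ≤ occ` -/

/-- If `√(cN) ≤ b + √(cN)/4` in `ℝ≥0∞` then `(c/4) N ≤ b²` (indeed `(9/16) c N ≤ b²`). [folklore] -/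
private theorem ofReal_quarter_mul_le_sq {c : ℝ} (hc : 0 ≤ c) (N : ℕ) {b : ℝ≥0∞}
    (h : ENNReal.ofReal (Real.sqrt (c * N)) ≤ b + ENNReal.ofReal (Real.sqrt (c * N) / 4)) :
    ENNReal.ofReal (c / 4 * N) ≤ b ^ 2 := by
  have hcN : 0 ≤ c * N := by positivity
  have h1 : ENNReal.ofReal (3 / 4 * Real.sqrt (c * N)) ≤ b := by
    rw [show 3 / 4 * Real.sqrt (c * N) = Real.sqrt (c * N) - Real.sqrt (c * N) / 4 by ring,
      ENNReal.ofReal_sub _ (by positivity)]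
    exact tsub_le_iff_right.2 h
  calc ENNReal.ofReal (c / 4 * N) ≤ ENNReal.ofReal ((3 / 4 * Real.sqrt (c * N)) ^ 2) := by
        refine ENNReal.ofReal_le_ofReal ?_
        rw [mul_pow, Real.sq_sqrt hcN]
        nlinarith
    _ = ENNReal.ofReal (3 / 4 * Real.sqrt (c * N)) ^ 2 := by
        rw [ENNReal.ofReal_pow (by positivity)]
    _ ≤ b ^ 2 := by gcongr

/-! ### The registered stub -/

/-- **Registered stub `stub_nearMinimiserTransfer`** (line `Sketch` of crux
stmt-AtomisticToContinuum-9483). [folklore] -/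
theorem stub_nearMinimiserTransfer :
    (∀ v : ℝ → ℝ≥0∞, IsRepulsiveFiniteRange v → ∃ ρ₀ : ℝ, 0 < ρ₀ ∧ ∀ ρ : ℝ, 0 < ρ → ρ < ρ₀ →
      ∃ θ : ℝ, 0 < θ ∧ θ < 1 / 2 ∧ ∃ c : ℝ, 0 < c ∧ ∀ᶠ N : ℕ in atTop, ∀ ε : ℝ≥0∞, 0 < ε →
        ∃ Φ : TrialState N (sideLength ρ N),
          energy v Φ ≤ groundStateEnergy v N (sideLength ρ N) + ε ∧
            ENNReal.ofReal (c * N) ≤ occupation N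
              (Set.indicator {x : Space | ∀ t, x t ∈ Set.Ioo (θ * sideLength ρ N)
                  (sideLength ρ N - θ * sideLength ρ N)}
                (fun _ => ((Real.sqrt (((1 - 2 * θ) * sideLength ρ N) ^ 3))⁻¹ : ℂ))) Φ.ψ) →
    BECWallDressingTransfer.GroundStateRigidity →
    ∀ v : ℝ → ℝ≥0∞, IsRepulsiveFiniteRange v → ∃ ρ₀ : ℝ, 0 < ρ₀ ∧ ∀ ρ : ℝ, 0 < ρ → ρ < ρ₀ →
      ∃ θ : ℝ, 0 < θ ∧ θ < 1 / 2 ∧ ∃ c : ℝ, 0 < c ∧ ∀ᶠ N : ℕ in atTop, ∃ δ : ℝ≥0∞, 0 < δ ∧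
        ∀ Ψ : TrialState N (sideLength ρ N),
          energy v Ψ ≤ groundStateEnergy v N (sideLength ρ N) + δ →
            ENNReal.ofReal (c * N) ≤ occupation N
              (Set.indicator {x : Space | ∀ t, x t ∈ Set.Ioo (θ * sideLength ρ N)
                  (sideLength ρ N - θ * sideLength ρ N)}
                (fun _ => ((Real.sqrt (((1 - 2 * θ) * sideLength ρ N) ^ 3))⁻¹ : ℂ))) Ψ.ψ := by
  intro hC hR v hv
  obtain ⟨ρ₁, hρ₁, H1⟩ := hC v hv
  obtain ⟨ρ₂, hρ₂, H2⟩ := hR v hv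
  refine ⟨min ρ₁ ρ₂, lt_min hρ₁ hρ₂, fun ρ hρ hρlt => ?_⟩
  obtain ⟨θ, hθ0, hθ, c, hc, hev1⟩ := H1 ρ hρ (hρlt.trans_le (min_le_left _ _))
  have hev2 := H2 ρ hρ (hρlt.trans_le (min_le_right _ _))
  refine ⟨θ, hθ0, hθ, c / 4, by positivity, ?_⟩
  filter_upwards [hev1, hev2, eventually_gt_atTop 0] with N hN1 hN2 hNpos
  -- abbreviations: the side `L = L_N(ρ) > 0` and the inner flat mode `φ`
  set L : ℝ := sideLength ρ N with hLdef
  have hL : 0 < L := by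
    rw [hLdef]
    unfold sideLength
    exact Real.rpow_pos_of_pos (div_pos (Nat.cast_pos.mpr hNpos) hρ) _
  set φ : Space → ℂ := Set.indicator {x : Space | ∀ t, x t ∈ Set.Ioo (θ * L) (L - θ * L)}
      (fun _ => ((Real.sqrt (((1 - 2 * θ) * L) ^ 3))⁻¹ : ℂ)) with hφdef
  -- `η = c/16`, `δ` from rigidity, the condensed competitor `Φ` at slack `δ`
  obtain ⟨δ, hδ, hrig⟩ := hN2 (c / 16) (by positivity)
  obtain ⟨Φ, hΦE, hΦocc⟩ := hN1 δ hδ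
  refine ⟨δ, hδ, fun Ψ hΨE => ?_⟩
  obtain ⟨c₁, hc₁, hdist⟩ := hrig Ψ Φ hΨE hΦE
  -- the mode: measurable, bounded, supported in the cell, normalised
  have hφm : Measurable φ := measurable_const.indicator (measurableSet_coordCube _ _)
  have hφC : ∀ x, ‖φ x‖ ≤ ‖((Real.sqrt (((1 - 2 * θ) * L) ^ 3))⁻¹ : ℂ)‖ := fun x =>
    norm_indicator_le_norm_self _ x
  have hθL : 0 ≤ θ * L := by positivity
  have hφ0 : ∀ x, x ∉ cell L → φ x = 0 := by
    intro x hx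
    refine Set.indicator_of_notMem (fun hxS => hx ?_) _
    simp only [cell, Set.mem_setOf_eq]
    intro k
    exact ⟨hθL.trans (hxS k).1.le, (hxS k).2.trans_le (sub_le_self _ hθL)⟩
  have h12 : 0 < (1 - 2 * θ) * L := mul_pos (by linarith) hL
  have hφ1 : ∫⁻ x, (‖φ x‖₊ : ℝ≥0∞) ^ 2 ≤ 1 := (lintegral_innerFlatMode_sq h12).le
  -- `√occ(Φ) ≤ √occ(Ψ) + √(N c/16)`
  have hkey := occupation_rpow_half_le_add_of_sq_dist_le hφm hφC hφ0 hφ1 Ψ Φ hc₁ hdist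
  have hsq : ∀ x : ℝ≥0∞, (x ^ (1 / 2 : ℝ)) ^ 2 = x := fun x => by
    rw [← ENNReal.rpow_two, ← ENNReal.rpow_mul]
    norm_num
  have hcN : 0 ≤ c * N := by positivity
  have h1 : ENNReal.ofReal (Real.sqrt (c * N)) ≤ occupation N φ Φ.ψ ^ (1 / 2 : ℝ) := by
    rw [← ofReal_rpow_half_eq_sqrt hcN]
    exact ENNReal.rpow_le_rpow hΦocc (by norm_num)
  have h2 : ((N : ℝ≥0∞) * ENNReal.ofReal (c / 16)) ^ (1 / 2 : ℝ) =
      ENNReal.ofReal (Real.sqrt (c * N) / 4) := by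
    rw [← ENNReal.ofReal_natCast, ← ENNReal.ofReal_mul (Nat.cast_nonneg N),
      ofReal_rpow_half_eq_sqrt (by positivity)]
    congr 1
    rw [show (N : ℝ) * (c / 16) = (Real.sqrt (c * N) / 4) ^ 2 by
      rw [div_pow, Real.sq_sqrt hcN]; ring]
    exact Real.sqrt_sq (by positivity)
  rw [h2] at hkey
  rw [← hsq (occupation N φ Ψ.ψ)]
  exact ofReal_quarter_mul_le_sq hc.le N (h1.trans hkey)

end Summit.AtomisticToContinuum.BoseEinsteinCondensation.TorusInTheBox

end
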